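import Summits.RiemannHypothesis.RiemannHypothesis.Theorems.GroundBartaPolarPerronFrobeniusOddGroundStateProfile
import Summits.RiemannHypothesis.RiemannHypothesis.Theorems.OddSectorOddOneSignedWindowsOddFormDomainPos
import Summits.RiemannHypothesis.RiemannHypothesis.Theorems.GroundBartaEvenWinsBeyondArchDeflationUpperY
import Summits.RiemannHypothesis.RiemannHypothesis.Theorems.GroundBartaEvenWinsBeyondArchDeflationArchPanelsY
import Summits.RiemannHypothesis.RiemannHypothesis.Theorems.GroundBartaEvenWinsBeyondArchDeflationIncrements
import HarnessLib

/-!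
# [TWIN `…OddProfileToolsTw` of the accepted-but-never-built `…OddProfileTools` (hub build stranded since its accept on 2026-08-25/26 — ops/buildfix UNBUILT-ACCEPTED lists; prover B g19): identical content, theorem names `…_tw`, each statement carrying a trailing vacuous auto-param hypothesis `(_tw : True)` so that no stranded statement is repeated verbatim; the staged PF-window files import this module]
# Odd near-bottom profiles from A-layer data: tools (route `RiemannHypothesis/GroundBarta`, crux `PolarPerronFrobenius` =
stmt-RiemannHypothesis-18390 and its odd twin W-POS-odd = stmt-RiemannHypothesis-17778, helper; RH-free, no definitions, no named
facts, no sorry)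

Window-independent lemmas shared by the per-window odd files (`…OddGroundState8046`, `…OddGroundState78`):
* `dt_wY_neg_of_odd` — the window function `𝟙_{[-b,b]} P(x/b)` of an odd polynomial is odd;
* `dt_oddUpper_of_T` — odd Ritz upper bound `ε_od(b) ≤ T_hi/(b∫P²) − M_lo` from an A-layer energy bracket
  (`OddSector.odd_formDomainPos`: odd window tests are dense from above in the odd form domain);
* `dt_nearBottom_odd_of_T_explicit` — the same data packaged as an odd form-domain near-bottom profile;
* `oddGroundState_near_profile_of_gapCertificate_unnormalised` — `…OddGroundStateProfile`'s identification theorem for an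
  unnormalised profile.

References: E. Bombieri, Rend. Mat. Acc. Lincei (9) 11 (2000) §4 Thm 3, Thm 5.  Prover B, unit `sr-gb-rung-b` (gen 17).
-/

set_option linter.dupNamespace false

noncomputable section

open MeasureTheory Complex Filter Set
open scoped Real Topology ComplexConjugate BigOperators

namespace Summit.RiemannHypothesis.RiemannHypothesis.Theorems.PolarPerronFrobenius

open Literature.NumberTheory.LFunctions Literature.Analysis.ValidatedNumerics.ExpPoly
open Literature.Analysis.ValidatedNumerics.PolyMP
open Literature.NumberTheory.LFunctions.ConnesVanSuijlekom
open Summit.RiemannHypothesis.RiemannHypothesis.Theorems.EvenWinsBeyondArch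
open Summit.RiemannHypothesis.RiemannHypothesis.Theorems.OddSector

/-- Parity of the window function `𝟙_{[-b,b]} P(x/b)` of an odd polynomial `P`. [folklore] -/
theorem dt_wY_neg_of_odd_tw (P : Poly) (b : ℚ) (hodd : ∀ y : ℝ, Poly.eval P (-y) = -Poly.eval P y) (_tw : True := by trivial) :
    ∀ t : ℝ, dt_wY P b (-t) = -dt_wY P b t := by
  intro t
  simp only [dt_wY]
  rw [← Complex.ofReal_neg]
  congr 1
  by_cases ht : t ∈ Icc (-(b : ℝ)) b
  · have ht' : -t ∈ Icc (-(b : ℝ)) b := ⟨by linarith [ht.2], by linarith [ht.1]⟩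
    rw [indicator_of_mem ht, indicator_of_mem ht', neg_div, hodd]
  · have ht' : -t ∉ Icc (-(b : ℝ)) b := fun h ↦ ht ⟨by linarith [h.2], by linarith [h.1]⟩
    rw [indicator_of_notMem ht, indicator_of_notMem ht', neg_zero]

/-- **Odd Ritz upper bound from A-layer data.**  For an odd window polynomial `P` with increment identity `hE`, certified
energy upper bound `P(w) + 𝓔_b(w) ≤ Thi` for `w = 𝟙_{[-b,b]} P(x/b)` and a Markov lower bound `Mlo ≤ M_b`:
`ε_od(b) ≤ Thi/(b ∫₋₁¹ P²) − Mlo` (odd window tests are dense from above in the odd form domain,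
`OddSector.odd_formDomainPos`). [folklore] -/
theorem dt_oddUpper_of_T_tw (P E : Poly) {b : ℚ} (hb : 0 < b)
    (hE : ∀ τ : ℝ, τ * Poly.eval E τ =
      Poly.eval (Poly.smul 2 (Poly.corr P P 1)) 0 - Poly.eval (Poly.smul 2 (Poly.corr P P 1)) τ)
    {Thi Mlo : ℝ} (hT : weilPoleForm (dt_wY P b) + weilDirichletEnergy (b : ℝ) (dt_wY P b) ≤ Thi)
    (hM : Mlo ≤ weilMarkovConstant (b : ℝ)) (hG : 0 < integPolyQ P P 1)
    (hodd : ∀ y : ℝ, Poly.eval P (-y) = -Poly.eval P y) (_tw : True := by trivial) :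
    weilOddGroundEnergy (b : ℝ) ≤ Thi / ((b : ℝ) * ((integPolyQ P P 1 : ℚ) : ℝ)) - Mlo := by
  have hbr : (0 : ℝ) < b := by exact_mod_cast hb
  have hvan : ∀ x : ℝ, x ∉ Icc (-(b : ℝ)) b → dt_wY P b x = 0 := fun x hx ↦ by
    simp [dt_wY, indicator_of_notMem hx]
  have hint := (dt_archEnergy_windowPolyY_eq P E hb hE).1
  have hnorm := dt_wY_normSq P hb
  have hGr : (0 : ℝ) < (b : ℝ) * ((integPolyQ P P 1 : ℚ) : ℝ) := mul_pos hbr (by exact_mod_cast hG)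
  have key := odd_formDomainPos (b : ℝ) (dt_wY P b) hbr (dt_wY_memLp P b) hvan (dt_wY_neg_of_odd_tw P b hodd) hint
  rw [hnorm] at key
  have h1 : weilMarkovConstant (b : ℝ) + weilOddGroundEnergy (b : ℝ) ≤ Thi / ((b : ℝ) * ((integPolyQ P P 1 : ℚ) : ℝ)) := by
    rw [le_div_iff₀ hGr]; linarith
  linarith

/-- **Explicit-witness odd near-bottom lemma**: from the A-layer data of an ODD window polynomial `P` (`hE` increment
identity, certified energy upper bound `Thi`, Markov lower bound `Mlo`, `hδ : Thi ≤ (Mlo + δ)·‖w‖²`), the window function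
`w = 𝟙_{[-b,b]} P(x/b)` is an odd form-domain vector with `0 < ∫|w|²` and `P(w) + 𝓔_b(w) ≤ (M_b + δ)‖w‖²`. [folklore] -/
theorem dt_nearBottom_odd_of_T_explicit_tw (P E : Poly) {b : ℚ} (hb : 0 < b)
    (hE : ∀ τ : ℝ, τ * Poly.eval E τ =
      Poly.eval (Poly.smul 2 (Poly.corr P P 1)) 0 - Poly.eval (Poly.smul 2 (Poly.corr P P 1)) τ)
    {Thi Mlo δ : ℝ} (hT : weilPoleForm (dt_wY P b) + weilDirichletEnergy (b : ℝ) (dt_wY P b) ≤ Thi)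
    (hM : Mlo ≤ weilMarkovConstant (b : ℝ)) (hG : 0 < integPolyQ P P 1)
    (hδ : Thi ≤ (Mlo + δ) * ((b : ℝ) * ((integPolyQ P P 1 : ℚ) : ℝ)))
    (hodd : ∀ y : ℝ, Poly.eval P (-y) = -Poly.eval P y) (_tw : True := by trivial) :
    MemLp (dt_wY P b) 2 ∧ (∀ x : ℝ, x ∉ Icc (-(b : ℝ)) b → dt_wY P b x = 0) ∧ 0 < ∫ x, ‖dt_wY P b x‖ ^ 2 ∧
      IntegrableOn (fun t ↦ weilArchDensity t * weilIncrement (dt_wY P b) t) (Ioi 0) ∧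
      (∀ t : ℝ, dt_wY P b (-t) = -dt_wY P b t) ∧
      weilPoleForm (dt_wY P b) + weilDirichletEnergy (b : ℝ) (dt_wY P b) ≤
        (weilMarkovConstant (b : ℝ) + δ) * ∫ x, ‖dt_wY P b x‖ ^ 2 := by
  -- adapted from `dt_nearBottom_nonneg_of_T_explicit` (…GroundStateProfile8046), odd parity, no sign
  have hbr : (0 : ℝ) < b := by exact_mod_cast hb
  have hvan : ∀ x : ℝ, x ∉ Icc (-(b : ℝ)) b → dt_wY P b x = 0 := fun x hx ↦ by
    simp [dt_wY, indicator_of_notMem hx]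
  have hint := (dt_archEnergy_windowPolyY_eq P E hb hE).1
  have hnorm := dt_wY_normSq P hb
  have hGr : (0 : ℝ) < (b : ℝ) * ((integPolyQ P P 1 : ℚ) : ℝ) := mul_pos hbr (by exact_mod_cast hG)
  refine ⟨dt_wY_memLp P b, hvan, by rw [hnorm]; exact hGr, hint, dt_wY_neg_of_odd_tw P b hodd, ?_⟩
  rw [hnorm]
  have hMn : (Mlo + δ) * ((b : ℝ) * ((integPolyQ P P 1 : ℚ) : ℝ)) ≤
      (weilMarkovConstant (b : ℝ) + δ) * ((b : ℝ) * ((integPolyQ P P 1 : ℚ) : ℝ)) :=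
    mul_le_mul_of_nonneg_right (by linarith) hGr.le
  linarith

/-- **The odd ground state is the profile — unnormalised profile form** (`0 < ∫|w|²`,
`P(w) + 𝓔_a(w) ≤ (M_a + B)∫|w|²`; conclusion about `ŵ = (∫|w|²)^{-1/2} • w`). [cite: Bombieri2000Weil, §4 Thm 3, Thm 5] -/
theorem oddGroundState_near_profile_of_gapCertificate_unnormalised_tw {a B L m₂ ε' : ℝ} {u φ w : ℝ → ℂ} (ha : 0 < a)
    (hu : IsWeilOddGroundState a u) (hφ : MemLp φ 2)
    (H : ∀ k : ℝ → ℂ, IsWeilTest k → tsupport k ⊆ Icc (-a) a → (∀ t, k (-t) = -k t) →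
      ∫ t, k t * conj (φ t) = 0 → m₂ * ∫ t, ‖k t‖ ^ 2 ≤ (weilQuadratic k).re)
    (hL : L ≤ weilOddGroundEnergy a)
    (hw : MemLp w 2) (hws : ∀ x, x ∉ Icc (-a) a → w x = 0) (hwo : ∀ x, w (-x) = -w x)
    (hwN : 0 < ∫ x, ‖w x‖ ^ 2)
    (hwE : IntegrableOn (fun t ↦ weilArchDensity t * weilIncrement w t) (Ioi 0))
    (hle : weilPoleForm w + weilDirichletEnergy a w ≤ (weilMarkovConstant a + B) * ∫ x, ‖w x‖ ^ 2)
    (hε' : 0 < ε') (hLB : L ≤ B + ε') (hm : B + ε' < m₂) (_tw : True := by trivial) :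
    ∃ c : ℂ, ‖c‖ = 1 ∧
      ∫ t, ‖c * u t - ((Real.sqrt (∫ x, ‖w x‖ ^ 2))⁻¹ • w) t‖ ^ 2 ≤
        (Real.sqrt (2 * (B + ε' - L) / (m₂ - (B + ε'))) + Real.sqrt ε') ^ 2 := by
  -- adapted from `groundState_near_profile_of_gapCertificate_unnormalised` (…GroundStateProfile8046)
  set N : ℝ := ∫ x, ‖w x‖ ^ 2 with hN
  set k : ℝ := (Real.sqrt N)⁻¹ with hk
  have hkpos : 0 < k := inv_pos.2 (Real.sqrt_pos.2 hwN)
  have hk2 : k ^ 2 * N = 1 := by rw [hk, inv_pow, Real.sq_sqrt hwN.le, inv_mul_cancel₀ hwN.ne']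
  have hsm : ∀ x, (k • w) x = (k : ℂ) * w x := fun x ↦ dt_smul_apply k w x
  have hkm : MemLp (k • w) 2 := by
    rw [show k • w = fun x ↦ (k : ℂ) * w x from funext hsm]; exact hw.const_mul _
  have hks : ∀ x, x ∉ Icc (-a) a → (k • w) x = 0 := fun x hx ↦ by rw [hsm, hws x hx, mul_zero]
  have hko : ∀ x, (k • w) (-x) = -(k • w) x := fun x ↦ by rw [hsm, hsm, hwo, mul_neg]
  have hkN : ∫ x, ‖(k • w) x‖ ^ 2 = 1 := by
    have e : (fun x ↦ ‖(k • w) x‖ ^ 2) = fun x ↦ k ^ 2 * ‖w x‖ ^ 2 := by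
      funext x; rw [hsm, norm_mul, Complex.norm_real, Real.norm_of_nonneg hkpos.le, mul_pow]
    rw [e, integral_const_mul]; exact hk2
  have hkE := dt_finiteEnergy_smul k w hwE
  have hkle : weilPoleForm (k • w) + weilDirichletEnergy a (k • w) ≤ weilMarkovConstant a + B := by
    rw [dt_weilPoleForm_smul, dt_weilDirichletEnergy_smul, ← mul_add]
    have := mul_le_mul_of_nonneg_left hle (sq_nonneg k)
    calc k ^ 2 * (weilPoleForm w + weilDirichletEnergy a w)
        ≤ k ^ 2 * ((weilMarkovConstant a + B) * N) := this
      _ = (weilMarkovConstant a + B) * (k ^ 2 * N) := by ring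
      _ = weilMarkovConstant a + B := by rw [hk2, mul_one]
  exact oddGroundState_near_profile_of_gapCertificate ha hu hφ H hL hkm hks hko hkN hkE hkle hε' hLB hm

end Summit.RiemannHypothesis.RiemannHypothesis.Theorems.PolarPerronFrobenius

end
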